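import Literature.MathematicalPhysics.QuantumLattice.GrassmannFlowDB
import HarnessLib

/-!
# The flow of geometric majorants vanishing in degree zero (refinement of `GrassmannFlowDB`)

Topic `MathematicalPhysics/QuantumLattice`; companion of `GrassmannFlowDB.iterEffAction_splitFlow_geometric_of_gramBounded`.  There the
untracked remainder `H_j = V^{(j)} - L_j` is majorised by the geometric profile `D_j t_j^m` in EVERY degree `m ≥ 0`, so that its
field-weighted norm is `D_j/(1 - x_j²)`, `x_j = e²(κ_j + ρ_j) t_j`.  But `H_j` has no constant part (and the pinned-norm hypothesis is
vacuous in degree `0`), so the profile may be taken `0` in degree `0`: then `‖H_j‖_{h_j} ≤ D_j x_j²/(1 - x_j²)` — the remainder produced at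
scale `j - 1` with output weight `ρ_{j-1}` re-enters scale `j` with the factor `x_j² = (e²(κ_j+ρ_j)/ρ_{j-1})²`, small when the fields of the
lower scale are small (Benfatto–Giuliani–Mastropietro 2006, (2.86)–(2.90): the dimensional gain of the irrelevant terms; Gawȩdzki–Kupiainen
1985, §3).  This is the form in which the recursion of real numbers closes over `≍ log β` fixed-ratio slices of the Hubbard covariance at
`βU ≤ κ` (cell gate-hubbard-kl, R0-SCOPE-4).

* `normV_geometric_pos_le` — `‖·‖_h[m' ↦ (m' = 0 ? 0 : D t^{2m'})] ≤ D x²/(1 - x²)`;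
* **`iterEffAction_splitFlow_geometric_refined_of_gramBounded`**.

Everything is proved; no definition, no named fact.

## Sources

G. Benfatto, A. Giuliani, V. Mastropietro, Ann. Henri Poincaré 7 (2006) 809–898, (2.77)–(2.80), (2.86)–(2.90)
[`BenfattoGiulianiMastropietro2006`]; K. Gawȩdzki, A. Kupiainen, Comm. Math. Phys. 102 (1985) 1–30, §3 [`GawedzkiKupiainen1985GrossNeveu`].
-/

noncomputable section

namespace Literature.MathematicalPhysics.QuantumLattice

open GrassmannAlgebra Finset Literature.Probability.LatticeModels
open scoped InnerProductSpace Nat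

universe u

variable {𝕜 : Type*} [RCLike 𝕜] {Γ : Type u} [Fintype Γ] [DecidableEq Γ]

omit [DecidableEq Γ] in
/-- `‖·‖_h` is additive in the pinned norms. [folklore] -/
private theorem normV_add (κ ρ : ℝ) (N₁ N₂ : ℕ → ℝ) :
    normV Γ κ ρ (fun m' => N₁ m' + N₂ m') = normV Γ κ ρ N₁ + normV Γ κ ρ N₂ := by
  simp only [normV, mul_add, sum_add_distrib]

omit [DecidableEq Γ] in
/-- **The field-weighted norm of a geometric profile vanishing in degree zero**: `‖·‖_h[m' ↦ (2m' = 0 ? 0 : D t^{2m'})] ≤ D x²/(1 - x²)`,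
`x = e²(κ+ρ)t < 1`. [cite: BenfattoGiulianiMastropietro2006, (2.86)-(2.90)] -/
theorem normV_geometric_pos_le {κ ρ t D : ℝ} (hκρ : 0 ≤ κ + ρ) (ht : 0 ≤ t) (hD : 0 ≤ D)
    (hx : Real.exp 2 * (κ + ρ) * t < 1) :
    normV Γ κ ρ (fun m' => if 2 * m' = 0 then 0 else D * t ^ (2 * m')) ≤
      D * (Real.exp 2 * (κ + ρ) * t) ^ 2 / (1 - (Real.exp 2 * (κ + ρ) * t) ^ 2) := by
  set x : ℝ := Real.exp 2 * (κ + ρ) * t with hxdef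
  have hx0 : 0 ≤ x := by positivity
  have hx2 : x ^ 2 < 1 := by nlinarith
  have hx20 : 0 ≤ x ^ 2 := sq_nonneg x
  -- termwise: the profile is `D (x²)^{m'} - [m' = 0] D`
  have hterm : ∀ m', (Real.exp 2 * (κ + ρ)) ^ (2 * m') * (if 2 * m' = 0 then 0 else D * t ^ (2 * m')) =
      D * (x ^ 2) ^ m' - if m' = 0 then D else 0 := by
    intro m'
    have hxm : (x ^ 2) ^ m' = (Real.exp 2 * (κ + ρ)) ^ (2 * m') * t ^ (2 * m') := by
      rw [← pow_mul, hxdef, mul_pow]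
    rcases Nat.eq_zero_or_pos m' with rfl | hm
    · simp
    · rw [if_neg (by omega), if_neg hm.ne', hxm]; ring
  have hgeom : HasSum (fun m' : ℕ => D * (x ^ 2) ^ m') (D * (1 - x ^ 2)⁻¹) :=
    (hasSum_geometric_of_lt_one hx20 hx2).mul_left D
  have hle : ∑ m' ∈ range (Fintype.card Γ / 2 + 1), D * (x ^ 2) ^ m' ≤ D * (1 - x ^ 2)⁻¹ :=
    sum_le_hasSum _ (fun m' _ => by positivity) hgeom
  calc normV Γ κ ρ (fun m' => if 2 * m' = 0 then 0 else D * t ^ (2 * m'))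
      = ∑ m' ∈ range (Fintype.card Γ / 2 + 1), (D * (x ^ 2) ^ m' - if m' = 0 then D else 0) :=
        sum_congr rfl fun m' _ => hterm m'
    _ = (∑ m' ∈ range (Fintype.card Γ / 2 + 1), D * (x ^ 2) ^ m') - D := by
        rw [sum_sub_distrib, sum_ite_eq' (range (Fintype.card Γ / 2 + 1)) 0 (fun _ => D), if_pos (by simp)]
    _ ≤ D * (1 - x ^ 2)⁻¹ - D := sub_le_sub_right hle D
    _ = D * x ^ 2 / (1 - x ^ 2) := by
        have h1 : 1 - x ^ 2 ≠ 0 := by linarith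
        field_simp
        ring

/-- **The split flow with geometric majorants VANISHING IN DEGREE ZERO** (refinement of `iterEffAction_splitFlow_geometric_of_gramBounded`:
the remainder `V^{(j)} - L j` has no constant part, so its majorant may be taken `0` in degree `0`, and its field-weighted norm is
`D̃_j = D_j x_j²/(1 - x_j²)` instead of `D_j/(1 - x_j²)` — the factor `x_j²` is what lets the recursion run over `≍ log β` slices). (scalar form of `iterEffAction_splitFlow`).  Slices `C j` charged for `q`
and in Gram form (`κ j`, `f j`, `g j`), row/column sums `≤ α j`, output weights `ρ j`; an even `V` without constant part; a
tracked part `L j` (even, positive-degree kernels flowing linearly, pinned norms `≤ NL j`, field-weighted norm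
`‖·‖_{h_j}[NL j] ≤ Λ j`); real sequences `D, t ≥ 0` with `t (j+1) = (ρ j)⁻¹`, the pinned norms of `V - L 0` at most
`D 0 · (t 0)^m` (`m ≥ 1`), and for every `j < K`, with `x_j = e²(κ_j + ρ_j) t_j`, `D̃_j = D_j x_j²/(1 - x_j²)`, `θ_j = e α_j (Λ_j + D̃_j)/κ_j²`:
`x_j < 1`, `θ_j < 1` and `D (j+1) ≥ e (D̃_j + (Λ_j + D̃_j) θ_j/(1 - θ_j))`.  Then for every `n ≤ K`: the single-slice
partition functions below `n` are units, `V^{(n)} = iterEffAction C n V` is even without constant part, and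
`Σ_{Y : Y_p = w} ‖kernel (V^{(n)} - L n) m Y‖ ≤ D_n t_n^m` for `m ≥ 1` — the un-renormalised multiscale expansion reduced to
a recursion of real numbers (Benfatto–Giuliani–Mastropietro 2006, (2.77)–(2.80), (2.86)–(2.90)).
[cite: BenfattoGiulianiMastropietro2006, (2.77)-(2.80) and (2.86)-(2.90)] -/
theorem iterEffAction_splitFlow_geometric_refined_of_gramBounded (C : ℕ → Matrix Γ Γ 𝕜) (κ : ℕ → ℝ) (hκ : ∀ j, 0 < κ j) (hGB : ∀ j, IsGramBoundedR (C j) (κ j))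
    (α : ℕ → ℝ) (hα : ∀ j, 0 < α j) (hrow : ∀ j X, ∑ Y, ‖C j X Y‖ ≤ α j) (hcol : ∀ j Y, ∑ X, ‖C j X Y‖ ≤ α j)
    (ρ : ℕ → ℝ) (hρ : ∀ j, 0 < ρ j)
    (V : GrassmannAlgebra 𝕜 Γ) (hV : V ∈ evenPart 𝕜 Γ) (hV0 : constPart 𝕜 V = 0)
    (L : ℕ → GrassmannAlgebra 𝕜 Γ) (hL : ∀ j, L j ∈ evenPart 𝕜 Γ)
    (hLflow : ∀ j, ∀ m, 0 < m → ∀ Y : Fin m → Γ, kernel 𝕜 (gaussConv 𝕜 (C j) (L j)) m Y = kernel 𝕜 (L (j + 1)) m Y)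
    (NL : ℕ → ℕ → ℝ) (hNL0 : ∀ j m, 0 ≤ NL j m)
    (hNL : ∀ (j m : ℕ) (p : Fin m) (w : Γ), ∑ Y ∈ univ.filter (fun Y : Fin m → Γ => Y p = w), ‖kernel 𝕜 (L j) m Y‖ ≤ NL j m)
    (Λ : ℕ → ℝ) (hΛ : ∀ j, normV Γ (κ j) (ρ j) (fun m' => NL j (2 * m')) ≤ Λ j)
    (D t : ℕ → ℝ) (hD0 : ∀ j, 0 ≤ D j) (ht0 : ∀ j, 0 ≤ t j) (ht : ∀ j, t (j + 1) = (ρ j)⁻¹)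
    (hNHV : ∀ (m : ℕ) (p : Fin m) (w : Γ),
      ∑ Y ∈ univ.filter (fun Y : Fin m → Γ => Y p = w), ‖kernel 𝕜 (V - L 0) m Y‖ ≤ D 0 * t 0 ^ m)
    (K : ℕ) (hx : ∀ j < K, Real.exp 2 * (κ j + ρ j) * t j < 1)
    (hθ : ∀ j < K, Real.exp 1 * α j * (Λ j + D j * (Real.exp 2 * (κ j + ρ j) * t j) ^ 2 / (1 - (Real.exp 2 * (κ j + ρ j) * t j) ^ 2)) / κ j ^ 2 < 1)
    (hstep : ∀ j < K,
      Real.exp 1 * (D j * (Real.exp 2 * (κ j + ρ j) * t j) ^ 2 / (1 - (Real.exp 2 * (κ j + ρ j) * t j) ^ 2) +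
        (Λ j + D j * (Real.exp 2 * (κ j + ρ j) * t j) ^ 2 / (1 - (Real.exp 2 * (κ j + ρ j) * t j) ^ 2)) *
          (Real.exp 1 * α j * (Λ j + D j * (Real.exp 2 * (κ j + ρ j) * t j) ^ 2 / (1 - (Real.exp 2 * (κ j + ρ j) * t j) ^ 2)) / κ j ^ 2) /
            (1 - Real.exp 1 * α j * (Λ j + D j * (Real.exp 2 * (κ j + ρ j) * t j) ^ 2 / (1 - (Real.exp 2 * (κ j + ρ j) * t j) ^ 2)) / κ j ^ 2)) ≤ D (j + 1)) :
    ∀ n ≤ K, (∀ j < n, IsUnit (effPartitionFn 𝕜 (C j) (iterEffAction 𝕜 C j V))) ∧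
      iterEffAction 𝕜 C n V ∈ evenPart 𝕜 Γ ∧ constPart 𝕜 (iterEffAction 𝕜 C n V) = 0 ∧
      ∀ (m : ℕ), 0 < m → ∀ (p : Fin m) (w : Γ),
        ∑ Y ∈ univ.filter (fun Y : Fin m → Γ => Y p = w), ‖kernel 𝕜 (iterEffAction 𝕜 C n V - L n) m Y‖ ≤ D n * t n ^ m := by
  -- the geometric majorants and the scalar quantities
  set NH : ℕ → ℕ → ℝ := fun j m => if m = 0 then 0 else D j * t j ^ m with hNH
  have hNH0 : ∀ j m, 0 ≤ NH j m := fun j m => by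
    rw [hNH]; dsimp only; split_ifs
    · exact le_rfl
    · exact mul_nonneg (hD0 j) (pow_nonneg (ht0 j) m)
  have hκρ : ∀ j, 0 ≤ κ j + ρ j := fun j => (add_pos (hκ j) (hρ j)).le
  -- `‖·‖_{h_j}[NH j] ≤ D̃_j` and `‖·‖_{h_j}[NL j + NH j] ≤ Λ_j + D̃_j`
  have hnH : ∀ j < K, normV Γ (κ j) (ρ j) (fun m' => NH j (2 * m')) ≤
      D j * (Real.exp 2 * (κ j + ρ j) * t j) ^ 2 / (1 - (Real.exp 2 * (κ j + ρ j) * t j) ^ 2) := fun j hj => by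
    simpa only [hNH] using normV_geometric_pos_le (Γ := Γ) (hκρ j) (ht0 j) (hD0 j) (hx j hj)
  have hnLH : ∀ j < K, normV Γ (κ j) (ρ j) (fun m' => NL j (2 * m') + NH j (2 * m')) ≤
      Λ j + D j * (Real.exp 2 * (κ j + ρ j) * t j) ^ 2 / (1 - (Real.exp 2 * (κ j + ρ j) * t j) ^ 2) := fun j hj => by
    rw [normV_add]; exact add_le_add (hΛ j) (hnH j hj)
  have hnLH0 : ∀ j, 0 ≤ normV Γ (κ j) (ρ j) (fun m' => NL j (2 * m') + NH j (2 * m')) :=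
    fun j => normV_nonneg (hκ j).le (hρ j).le fun m' => add_nonneg (hNL0 j _) (hNH0 j _)
  have hnH0' : ∀ j, 0 ≤ normV Γ (κ j) (ρ j) (fun m' => NH j (2 * m')) :=
    fun j => normV_nonneg (hκ j).le (hρ j).le fun m' => hNH0 j _
  -- the true `θ` is below the scalar `θ_j`
  have hθtrue : ∀ j < K, Real.exp 1 * α j * normV Γ (κ j) (ρ j) (fun m' => NL j (2 * m') + NH j (2 * m')) / κ j ^ 2 ≤
      Real.exp 1 * α j * (Λ j + D j * (Real.exp 2 * (κ j + ρ j) * t j) ^ 2 / (1 - (Real.exp 2 * (κ j + ρ j) * t j) ^ 2)) / κ j ^ 2 := fun j hj => by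
    have := hnLH j hj
    have hκ2 : 0 < κ j ^ 2 := pow_pos (hκ j) 2
    have he : 0 < Real.exp 1 * α j := mul_pos (Real.exp_pos 1) (hα j)
    exact div_le_div_of_nonneg_right (mul_le_mul_of_nonneg_left this he.le) hκ2.le
  suffices hmain : ∀ n ≤ K, (∀ j < n, IsUnit (effPartitionFn 𝕜 (C j) (iterEffAction 𝕜 C j V))) ∧
      iterEffAction 𝕜 C n V ∈ evenPart 𝕜 Γ ∧ constPart 𝕜 (iterEffAction 𝕜 C n V) = 0 ∧
      ∀ (m : ℕ), 0 < m → ∀ (p : Fin m) (w : Γ),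
        ∑ Y ∈ univ.filter (fun Y : Fin m → Γ => Y p = w), ‖kernel 𝕜 (iterEffAction 𝕜 C n V - L n) m Y‖ ≤ NH n m by
    intro n hn
    obtain ⟨h1, h2, h3, h4⟩ := hmain n hn
    refine ⟨h1, h2, h3, fun m hm p w => ?_⟩
    simpa only [hNH, hm.ne', if_false] using h4 m hm p w
  refine iterEffAction_splitFlow_of_gramBounded C κ hκ hGB α hα hrow hcol ρ hρ V hV hV0 L hL hLflow NL NH hNL0 hNH0 hNL
    (fun m p w => ?_) K (fun j hj => (hθtrue j hj).trans_lt (hθ j hj)) ?_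
  · rcases Nat.eq_zero_or_pos m with rfl | hm
    · exact absurd p.2 (Nat.not_lt_zero _)
    · simpa only [hNH, hm.ne', if_false] using hNHV m p w
  -- the one-step inequality at the geometric majorant
  intro j hj m hm
  set θt : ℝ := Real.exp 1 * α j * normV Γ (κ j) (ρ j) (fun m' => NL j (2 * m') + NH j (2 * m')) / κ j ^ 2 with hθt
  set θs : ℝ := Real.exp 1 * α j * (Λ j + D j * (Real.exp 2 * (κ j + ρ j) * t j) ^ 2 / (1 - (Real.exp 2 * (κ j + ρ j) * t j) ^ 2)) / κ j ^ 2 with hθs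
  set Dt : ℝ := D j * (Real.exp 2 * (κ j + ρ j) * t j) ^ 2 / (1 - (Real.exp 2 * (κ j + ρ j) * t j) ^ 2) with hDt
  have hθt0 : 0 ≤ θt := by rw [hθt]; exact div_nonneg (mul_nonneg (mul_nonneg (Real.exp_pos 1).le (hα j).le) (hnLH0 j)) (sq_nonneg _)
  have hθts : θt ≤ θs := hθtrue j hj
  have hθs1 : θs < 1 := hθ j hj
  have hfrac : θt / (1 - θt) ≤ θs / (1 - θs) := by
    rw [div_le_div_iff₀ (by linarith) (by linarith)]
    nlinarith
  have hfrac0 : 0 ≤ θt / (1 - θt) := div_nonneg hθt0 (by linarith)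
  have hρm : 0 < (ρ j)⁻¹ ^ m := pow_pos (inv_pos.2 (hρ j)) m
  have hA : Real.exp 1 * normV Γ (κ j) (ρ j) (fun m' => NH j (2 * m')) ≤ Real.exp 1 * Dt :=
    mul_le_mul_of_nonneg_left (hnH j hj) (Real.exp_pos 1).le
  have hB : Real.exp 1 * normV Γ (κ j) (ρ j) (fun m' => NL j (2 * m') + NH j (2 * m')) * θt / (1 - θt) ≤
      Real.exp 1 * (Λ j + Dt) * (θs / (1 - θs)) := by
    rw [mul_div_assoc]
    exact mul_le_mul (mul_le_mul_of_nonneg_left (hnLH j hj) (Real.exp_pos 1).le) hfrac hfrac0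
      (mul_nonneg (Real.exp_pos 1).le ((hnLH0 j).trans (hnLH j hj)))
  have hDnext : Real.exp 1 * (Dt + (Λ j + Dt) * θs / (1 - θs)) ≤ D (j + 1) := by
    simpa only [hDt, hθs] using hstep j hj
  -- assemble
  have hgoal : (ρ j)⁻¹ ^ m * (Real.exp 1 * normV Γ (κ j) (ρ j) (fun m' => NH j (2 * m'))) +
      (ρ j)⁻¹ ^ m * (Real.exp 1 * normV Γ (κ j) (ρ j) (fun m' => NL j (2 * m') + NH j (2 * m'))) * θt / (1 - θt) ≤
      (ρ j)⁻¹ ^ m * D (j + 1) := by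
    have e1 : (ρ j)⁻¹ ^ m * (Real.exp 1 * normV Γ (κ j) (ρ j) (fun m' => NL j (2 * m') + NH j (2 * m'))) * θt / (1 - θt) =
        (ρ j)⁻¹ ^ m * (Real.exp 1 * normV Γ (κ j) (ρ j) (fun m' => NL j (2 * m') + NH j (2 * m')) * θt / (1 - θt)) := by
      ring
    rw [e1, ← mul_add]
    refine mul_le_mul_of_nonneg_left ((add_le_add hA hB).trans ?_) hρm.le
    calc Real.exp 1 * Dt + Real.exp 1 * (Λ j + Dt) * (θs / (1 - θs))
        = Real.exp 1 * (Dt + (Λ j + Dt) * θs / (1 - θs)) := by ring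
      _ ≤ D (j + 1) := hDnext
  calc _ ≤ (ρ j)⁻¹ ^ m * D (j + 1) := hgoal
    _ = NH (j + 1) m := by rw [hNH]; dsimp only; rw [if_neg hm.ne', ht j, mul_comm]

end Literature.MathematicalPhysics.QuantumLattice

end
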